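import Mathlib
import Literature.Geometry.Lorentzian.ExteriorRegionSchwarzschildEnd

/-!
# Negative lemmas for crux `StationaryLimitReduction` (route ZeroEnergyKerrOrBomb, item
stmt-FinalStateConjecture-10021) — kernel germs for the LOCK of the picked line `one-locked-explosion`
(cdisprove cycle 4, `Cruxes/StationaryLimitReduction/Disproof.lean` §10.4) and for the repair C′ of its stubs 6–7
(§10.3). Helpers only: nothing here asserts a Theses decl; no `def`, no named fact.

* `flatAmplitude_not_injective` — an EVEN flat amplitude `s ↦ e^{-1/s²}` (`expNegInvGlue (s²)`) is not injective, so an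
  escape curve built on it alone violates `Function.Injective F` of `IsChristodoulouGeneric`/`HasLocalEscape`.
* `strictMono_oddFlat`, `contDiff_oddFlat`, `injective_lockedCurveParam` — the ODD flat companion `s ↦ s e^{-1/s²}` is
  smooth and strictly monotone, hence the skeleton's phase-locked parameter
  `s ↦ (e^{-1/s²} cos(α/s²), e^{-1/s²} sin(α/s²), s e^{-1/s²})` is injective for every phase law `α`.
* `flat_seed_swamped` — `e^{-a u² + b u} u^p → 0` (`a > 0`): a flat seed, even grown until the arrival of a signal launched
  from radius `1/|s| = u`, is negligible against any polynomially small back-scatter; far-field modifications along the lock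
  curve must therefore sit outside the past light cone of the exit event (`R(s) s² → ∞`).
* `edge_caricature_orbit` — the explicit orbits `s = ρ tanh(ρ(t₀−t))`, `y = ρ sech(ρ(t₀−t))` of the planar system
  `ṡ = −y²`, `ẏ = s y`: each non-degenerate equilibrium `(σ,0)`, `σ > 0`, is unstable, yet every off-axis orbit reaches the
  degenerate edge `s = 0` in finite time — why the crux needs an EDGE statement (generic third law) beyond `KerrOrBomb`.
* `far_form_of_compact_form` — "for all points outside some compact set" implies "for all points of some far region
  `𝔢.far R₁`" for every asymptotically flat end (closedness at infinity, `AFEnd.exists_radius_far_disjoint`): the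
  abstract form of `SummitProperty → GoodFateAlong` (the repair C′ weakens stub 6's conclusion).
-/

set_option linter.dupNamespace false

open scoped Topology ContDiff
open Filter Set

namespace Summit.FinalStateConjecture.FinalStateConjecture.Theorems.StationaryLimitReduction.Negative

/-- An EVEN flat amplitude `s ↦ e^{-1/s²}` is not injective. [folklore] -/
theorem flatAmplitude_not_injective : ¬ Function.Injective (fun s : ℝ ↦ expNegInvGlue (s ^ 2)) := by
  intro h
  have h1 : (fun s : ℝ ↦ expNegInvGlue (s ^ 2)) 1 = (fun s : ℝ ↦ expNegInvGlue (s ^ 2)) (-1) := by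
    norm_num
  have := h h1
  norm_num at this

/-- The ODD flat companion `s ↦ s·e^{-1/s²}` is strictly monotone. [folklore] -/
theorem strictMono_oddFlat : StrictMono (fun s : ℝ ↦ s * expNegInvGlue (s ^ 2)) := by
  have hpos : ∀ s t : ℝ, 0 ≤ s → s < t → s * expNegInvGlue (s ^ 2) < t * expNegInvGlue (t ^ 2) := by
    intro s t hs hst
    have ht : 0 < t := hs.trans_lt hst
    have hgt : 0 < expNegInvGlue (t ^ 2) := expNegInvGlue.pos_of_pos (by positivity)
    have hmono : expNegInvGlue (s ^ 2) ≤ expNegInvGlue (t ^ 2) :=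
      expNegInvGlue.monotone (by nlinarith)
    calc s * expNegInvGlue (s ^ 2) ≤ s * expNegInvGlue (t ^ 2) :=
          mul_le_mul_of_nonneg_left hmono hs
      _ < t * expNegInvGlue (t ^ 2) := mul_lt_mul_of_pos_right hst hgt
  intro s t hst
  rcases le_or_gt 0 s with hs | hs
  · exact hpos s t hs hst
  · rcases le_or_gt t 0 with ht | ht
    · have h := hpos (-t) (-s) (by linarith) (by linarith)
      have e1 : (-t) ^ 2 = t ^ 2 := by ring
      have e2 : (-s) ^ 2 = s ^ 2 := by ring
      rw [e1, e2] at h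
      linarith
    · have hgs : 0 < expNegInvGlue (s ^ 2) := expNegInvGlue.pos_of_pos (by nlinarith)
      have hgt : 0 < expNegInvGlue (t ^ 2) := expNegInvGlue.pos_of_pos (by positivity)
      exact (mul_neg_of_neg_of_pos hs hgs).trans (mul_pos ht hgt)

/-- The odd flat companion is smooth. [folklore] -/
theorem contDiff_oddFlat : ContDiff ℝ ∞ (fun s : ℝ ↦ s * expNegInvGlue (s ^ 2)) :=
  contDiff_id.mul (expNegInvGlue.contDiff.comp (contDiff_id.pow 2))

/-- The phase-locked curve parameter `s ↦ (e^{-1/s²} cos(α/s²), e^{-1/s²} sin(α/s²), s e^{-1/s²})` is injective for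
every phase law `α` (third component). [folklore] -/
theorem injective_lockedCurveParam (α : ℝ) :
    Function.Injective (fun s : ℝ ↦ (expNegInvGlue (s ^ 2) * Real.cos (α / s ^ 2),
      expNegInvGlue (s ^ 2) * Real.sin (α / s ^ 2), s * expNegInvGlue (s ^ 2))) := by
  intro s t h
  exact strictMono_oddFlat.injective (congrArg (fun q : ℝ × ℝ × ℝ ↦ q.2.2) h)

/-- **A flat seed is swamped by any polynomial signal arriving before the exit**: for `a > 0`,
`e^{-a u² + b u} u^p → 0` as `u → ∞`. [folklore] -/
theorem flat_seed_swamped {a : ℝ} (ha : 0 < a) (b p : ℝ) :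
    Tendsto (fun u : ℝ ↦ Real.exp (-a * u ^ 2 + b * u) * u ^ p) atTop (𝓝 0) := by
  set c : ℝ := b + |p| with hc
  have h1 : Tendsto (fun u : ℝ ↦ -a * u ^ 2 + c * u) atTop atBot := by
    have e : (fun u : ℝ ↦ -a * u ^ 2 + c * u) = fun u ↦ u * (c + -(a * u)) := by
      funext u; ring
    rw [e]
    refine Filter.Tendsto.atTop_mul_atBot₀ tendsto_id ?_
    exact tendsto_atBot_add_const_left _ c
      (tendsto_neg_atTop_atBot.comp (tendsto_id.const_mul_atTop ha))
  have h2 : Tendsto (fun u : ℝ ↦ Real.exp (-a * u ^ 2 + c * u)) atTop (𝓝 0) :=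
    Real.tendsto_exp_atBot.comp h1
  refine squeeze_zero_norm' ?_ h2
  filter_upwards [eventually_ge_atTop (1 : ℝ)] with u hu
  have hu0 : 0 < u := by linarith
  have hlog : 0 ≤ Real.log u := Real.log_nonneg hu
  have hlogle : Real.log u ≤ u := (Real.log_le_sub_one_of_pos hu0).trans (by linarith)
  rw [Real.norm_eq_abs, abs_mul, Real.abs_exp, Real.abs_rpow_of_nonneg hu0.le, abs_of_pos hu0,
    Real.rpow_def_of_pos hu0, ← Real.exp_add]
  refine Real.exp_le_exp.2 ?_
  have : Real.log u * p ≤ |p| * u := by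
    calc Real.log u * p ≤ Real.log u * |p| := mul_le_mul_of_nonneg_left (le_abs_self p) hlog
      _ = |p| * Real.log u := by ring
      _ ≤ |p| * u := mul_le_mul_of_nonneg_left hlogle (abs_nonneg p)
  rw [hc]
  nlinarith

/-- **"Outside a compact set" implies "on a far region"**, for every asymptotically flat end: if for every `s > 0`
a property holds at all points outside some compact `B₁`, then for every `s > 0` it holds at all points of some far
region `𝔢.far R₁` — a compact set misses all sufficiently far regions (`AFEnd.exists_radius_far_disjoint`, the end is
closed at infinity; no sole-end hypothesis). This is the abstract form of "the summit's sojourn clause implies the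
one read along the end" (`SummitProperty → GoodFateAlong` of Disproof §10.3). [folklore] -/
theorem far_form_of_compact_form {X : Type} [TopologicalSpace X]
    [ChartedSpace Literature.Geometry.Lorentzian.E3 X] (𝔢 : Literature.Geometry.Lorentzian.AFEnd X)
    {Q : ℝ → X → Prop} (h : ∀ s : ℝ, 0 < s → ∃ B₁ : Set X, IsCompact B₁ ∧ ∀ p ∉ B₁, Q s p) :
    ∀ s : ℝ, 0 < s → ∃ R₁ : ℝ, ∀ p ∈ 𝔢.far R₁, Q s p := by
  intro s hs
  obtain ⟨B₁, hB₁, hQ⟩ := h s hs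
  obtain ⟨R₁, -, hdisj⟩ := 𝔢.exists_radius_far_disjoint hB₁
  exact ⟨R₁, fun p hp ↦ hQ p (Set.disjoint_left.1 (hdisj R₁ le_rfl) hp)⟩

/-- **Edge caricature** (Disproof §10.5; small model for "target + per-bomb repulsion ⇏ generic settling"). The planar system `ṡ = −y²`, `ẏ = s·y` (equilibria: the axis `{y = 0}`;
linearisation at `(σ, 0)` = `diag(0, σ)`, unstable for `σ > 0`) has the explicit orbits
`s = ρ tanh(ρ(t₀ − t))`, `y = ρ sech(ρ(t₀ − t))`: every such orbit has `s > 0` before `t₀` and reaches the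
degenerate edge `s = 0` AT time `t₀` with `y = ρ`. [folklore] -/
theorem edge_caricature_orbit (ρ t₀ : ℝ) :
    (∀ t, HasDerivAt (fun t ↦ ρ * Real.sinh (ρ * (t₀ - t)) / Real.cosh (ρ * (t₀ - t)))
        (-(ρ / Real.cosh (ρ * (t₀ - t))) ^ 2) t) ∧
    (∀ t, HasDerivAt (fun t ↦ ρ / Real.cosh (ρ * (t₀ - t)))
        ((ρ * Real.sinh (ρ * (t₀ - t)) / Real.cosh (ρ * (t₀ - t))) * (ρ / Real.cosh (ρ * (t₀ - t)))) t) ∧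
    ρ * Real.sinh (ρ * (t₀ - t₀)) / Real.cosh (ρ * (t₀ - t₀)) = 0 ∧ ρ / Real.cosh (ρ * (t₀ - t₀)) = ρ ∧
    (0 < ρ → ∀ t < t₀, 0 < ρ * Real.sinh (ρ * (t₀ - t)) / Real.cosh (ρ * (t₀ - t))) := by
  have hx : ∀ t, HasDerivAt (fun t ↦ ρ * (t₀ - t)) (ρ * -1) t := fun t ↦
    ((hasDerivAt_id t).const_sub t₀).const_mul ρ
  have hsinh : ∀ t, HasDerivAt (fun t ↦ Real.sinh (ρ * (t₀ - t)))
      (Real.cosh (ρ * (t₀ - t)) * (ρ * -1)) t := fun t ↦ (hx t).sinh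
  have hcosh : ∀ t, HasDerivAt (fun t ↦ Real.cosh (ρ * (t₀ - t)))
      (Real.sinh (ρ * (t₀ - t)) * (ρ * -1)) t := fun t ↦ (hx t).cosh
  refine ⟨fun t ↦ ?_, fun t ↦ ?_, by simp, by simp, fun hρ t ht ↦ ?_⟩
  · have hc : Real.cosh (ρ * (t₀ - t)) ≠ 0 := (Real.cosh_pos _).ne'
    have h := ((hsinh t).const_mul ρ).div (hcosh t) hc
    have hid := Real.cosh_sq_sub_sinh_sq (ρ * (t₀ - t))
    refine h.congr_deriv ?_
    rw [div_pow, div_eq_iff (pow_ne_zero 2 hc), neg_mul, div_mul_cancel₀ _ (pow_ne_zero 2 hc)]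
    linear_combination (-ρ ^ 2) * hid
  · have hc : Real.cosh (ρ * (t₀ - t)) ≠ 0 := (Real.cosh_pos _).ne'
    have h := (hasDerivAt_const t ρ).div (hcosh t) hc
    refine h.congr_deriv ?_
    rw [div_mul_div_comm, div_eq_div_iff (pow_ne_zero 2 hc) (mul_ne_zero hc hc)]
    ring
  · have h1 : 0 < ρ * (t₀ - t) := mul_pos hρ (by linarith)
    have h2 : 0 < Real.sinh (ρ * (t₀ - t)) := Real.sinh_pos_iff.2 h1
    have h3 : 0 < Real.cosh (ρ * (t₀ - t)) := Real.cosh_pos _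
    positivity

end Summit.FinalStateConjecture.FinalStateConjecture.Theorems.StationaryLimitReduction.Negative
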